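import Literature.MathematicalPhysics.QuantumFieldTheory.OSLorentzInvariantOfTimeContinuation
import Literature.MathematicalPhysics.QuantumFieldTheory.OSPointAllOrders
import HarnessLib

/-!
# (A₁₂) `OS1975_exists_forwardTube_continuation` from (A1) alone — the decomposition, assembled

Topic `Literature/MathematicalPhysics/QuantumFieldTheory`; composition file (theorems only, no
definitions, no named facts; librarian fact-decompose, 2026-08-16) for the named fact
`OS1975_exists_forwardTube_continuation` (`WightmanProofs.lean`; K. Osterwalder, R. Schrader,
*Axioms for Euclidean Green's functions II*, Comm. Math. Phys. 42 (1975), §IV.2, pp. 288–289: the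
analytic continuation of the Schwinger functions of an OS family with E0' to the forward tube with
tempered distributional boundary values), which a prove seat triaged XL and parked on (A1).
Sibling of `OSReconstructionOfTimeContinuation.lean`, which records the same state for the parent
`os_reconstruction`.

**Decision: no further decomposition.** The tree decomposed the printed proof as (A1) time
continuation `OS1975_exists_timeContinuation` (OS II Thm. 4.3, Ch. V–VI), (A2) tempered boundary
values with half-space spectral support, (B) Lorentz invariance of the boundary values and (D)
uniqueness on the time tube, assembled by `OS1975_exists_forwardTube_continuation_of_timeContinuation`
(`OSTimeContinuation.lean`). (A2), (B), (D) are by now theorems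
(`OS1975_boundaryValue_of_timeContinuation_holds`, `OS1973_lorentzInvariant_of_timeContinuation_holds`,
`eqOn_timeTube_of_timeRayBoundaryValue_holds`; jointly `OS1975_exists_continuation_halfSpace_of_A1`,
`OSLorentzInvariantOfTimeContinuation.lean`), so the fact hinges on the SINGLE existing named fact
(A1); splitting it again could only restate (A1). (A1) is in turn reduced in the tree to the
sum-form temperedness estimate (4.5) of OS II Thm. 4.1 (`HasPointSumBound`,
`OS1975_exists_timeContinuation_of_sumBound`, `OSPointAllOrders.lean`).

* `OS1975_exists_forwardTube_continuation_holds_of : OS1975_exists_timeContinuation → (A₁₂)`;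
* `OS1975_exists_forwardTube_continuation_of_sumBound` — (A₁₂) from the estimate (4.5) for every
  OS family with E0'.

The discharge `OS1975_exists_forwardTube_continuation_holds` is the first theorem applied to
`OS1975_exists_timeContinuation_holds` once (A1) lands.

## References

* [OsterwalderSchraderCMP1975] K. Osterwalder, R. Schrader, Axioms for Euclidean Green's
  functions II, Comm. Math. Phys. 42 (1975) 281–305, §IV.2 Thms. 4.1–4.3 and pp. 288–289,
  Ch. V–VI.
-/

noncomputable section

namespace Literature.MathematicalPhysics.QuantumFieldTheory

open Literature.MathematicalPhysics.QuantumLattice (SchwingerFamily SpaceTime)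
open Literature.MathematicalPhysics.QuantumLattice.SchwingerFamily

/-- **(A₁₂) `OS1975_exists_forwardTube_continuation` from (A1) alone**: the half-space
continuation (A₁₂⁺) from (A1) (`OS1975_exists_continuation_halfSpace_of_A1`; (A2), (B), (D) are
theorems), then forget the spectral clause (`OS1975_exists_forwardTube_continuation_of_halfSpace`).
Real proof (composition). [cite: OsterwalderSchraderCMP1975, §IV.2 pp. 288–289 with Thm. 4.3] -/
theorem OS1975_exists_forwardTube_continuation_holds_of (hA1 : OS1975_exists_timeContinuation) :
    OS1975_exists_forwardTube_continuation :=
  OS1975_exists_forwardTube_continuation_of_halfSpace (OS1975_exists_continuation_halfSpace_of_A1 hA1)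

/-- **(A₁₂) from the sum-form temperedness estimate (4.5)** (OS II Thm. 4.1, proved in Ch. VI.1):
`OS1975_exists_timeContinuation_of_sumBound` gives (A1), and the previous theorem concludes. Real
proof (composition). [cite: OsterwalderSchraderCMP1975, §IV.2 Thm. 4.1 (4.5) and Thm. 4.3] -/
theorem OS1975_exists_forwardTube_continuation_of_sumBound
    (h : ∀ (d : ℕ) [NeZero d] (S : SchwingerFamily (SpaceTime d)) (hOS : S.IsOSFamily)
      (hE0 : S.HasLinearGrowth), ∃ (t : ℕ) (γ : ℝ) (m : ℕ) (α₀ : ℕ → ℝ),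
        HasPointSumBound hOS.covariant hOS.reflectionPositive hE0 t γ m α₀) :
    OS1975_exists_forwardTube_continuation :=
  OS1975_exists_forwardTube_continuation_holds_of (OS1975_exists_timeContinuation_of_sumBound h)

end Literature.MathematicalPhysics.QuantumFieldTheory

end
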